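import Summits.Ventures.HodgeKum4.Theorems.KummerFixedLocusFixedPointsLocal
import Summits.Ventures.HodgeKum4.Theorems.KummerFixedLocusH3Assembly
import HarnessLib

/-!
# Route A ON `X` (continued): the point count, I1geo and `HC_Kum4Type` from a LOCAL split
# hypothesis — NO transport (T), NO Kummer-point input, NO (H2)  (cell `hodge-kum4`, seat p2 g5)

HONEST FRAMING.  Nothing here proves I1geo, `HC_Kum4Type` or the Hodge conjecture outright.  Every
theorem is CONDITIONAL on the printed statements it names (REFEREED Literature facts taken as
hypotheses), on p1's cell lemma L1 where stated, and on the LOCAL SPLIT HYPOTHESIS on the given `X`: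
«for every `g ∈ Γ(X) ∖ 1`, every fixed-point scheme `j : F ⟶ X` of `⟨g⟩` is the coproduct of `125`
sections `Spec ℂ ⟶ F`» — the shape Oguiso 2020 Prop. 3.5–3.6 PRINTS at the generalized Kummer
varieties `K⁴(A)` (`Hyperkaehler.Oguiso2020_fixedPointScheme_translation_generalizedKummerFour`) and
which is NOT a tree statement for a general `X` of `Kum⁴`-type (in print it is the routine
consequence of Hassett–Tschinkel 2013 Thm. 2.1 "`Aut₀` deforms with `X`" and Oguiso's count, as used
e.g. by Floccari, Compositio 160 (2024) Lemma 2.2 proof «since automorphisms in `Aut₀(K)` deform with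
`K`, their fixed loci deform as well»; the cell has NOT typed that synthesis — this file does not need
it as a named fact and does not introduce one).

WHAT IS PROVED (X-local forms of the landed Route-A theorems, module `KummerFixedLocusFixedPointsLocal`
§3 for the transitivity):
* `count_of_split` — for `X` smooth projective of `Kum⁴`-type with the split hypothesis, a Kummer fixed
  datum `(ι, W, i)`, `g ∈ Γ(X) ∖ 1` and a split fixed-point scheme `F = ⊔_{k<125} x k` of `⟨g⟩`:
  EXACTLY ONE of the points `x k ≫ j` lies on `W` (existence: odd torsor + dihedral fixed-space lemma +
  tangent-dimension fact, verbatim the (H3) argument of `…HasFixedPointTangent`; uniqueness: the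
  odd-torsor uniqueness `eq_of_fixed_of_transitive`, verbatim `…PointCountAssembly`).
* `fixedPointForm_of_split`, `meetsTranslates_of_split` — I1geo AT `(X, ι, W, i, g)`:
  `W ×_X gW ≅ Spec ℂ` (`IsPullback p p i (i ≫ g)`), via `fixedPointForm_of_split_fixedPointObject`
  (`…KummerPointAssembly`) and `isPullback_unit_iff` (`…FixedPointForm`).
* `kum4FixedFourfoldMeetsTranslates_of_fixedPointsSplit` — the route's I1geo statement
  `Kum4FixedFourfoldMeetsTranslates` (all `X`) from `Γ ≅ (ℤ/5)⁴` (FV, REFEREED), the tangent-dimension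
  fact (REFEREED textbook) and the split hypothesis for every `X` of `Kum⁴`-type (inline binder).
* `hc_kum4Type_of_L1_of_fixedPointsSplit` — `HC_Kum4Type ∧ HC_Kum4TypePowers` from FOURTEEN REFEREED
  named facts (the twelve of `hc_kum4Type_of_L1_of_meetsTranslates`, FV, the tangent-dimension fact),
  the split hypothesis for every `X` of `Kum⁴`-type, and L1: 16 binders, print-synthesis inputs NONE,
  the cohomological transport (T) and every Kummer-point statement ABSENT.
* `kum4FixedFourfoldMeetsTranslatesAtKummer_of_split_oguiso` — at `X = K⁴(A)` the split hypothesis IS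
  Oguiso's printed fact: the restricted residual `Kum4FixedFourfoldMeetsTranslatesAtKummer` from
  FV + Oguiso + the tangent-dimension fact in five lines (the landed chain's statement, re-derived).
Rung currency (cell ledger words unchanged by this file): it documents that the fixed-locus branch of
rung H3 on an arbitrary `X` hinges on ONE fibrewise statement on `X`; whether to replace the transport
(T) by a named fact of that shape is a director/literature decision, not made here.
-/

noncomputable section

open CategoryTheory CategoryTheory.Limits MonoidalCategory CartesianMonoidalCategory
open AlgebraicGeometry
open Literature.AlgebraicGeometry Literature.AlgebraicGeometry.Motives
open Literature.AlgebraicGeometry.Hyperkaehler Literature.AlgebraicGeometry.GroupActions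
open Literature.AlgebraicGeometry.HodgeTheory

namespace Summit.Ventures.HodgeKum4

namespace FixedPointsLocal

/-! ### §4 The point count on `X` from the split hypothesis -/

/-- **The point count ON `X`** (X-local form of `kum4FixedPointCountAtKummer_of_tangentFixed'`): for
`X` smooth projective of `Kum⁴`-type satisfying the split hypothesis `hsplit`, a Kummer fixed datum
`(ι, W, i)`, `g ∈ Γ(X) ∖ 1` and a fixed-point scheme `j : F ⟶ X` of `⟨g⟩` split into `125` sections
`x k`, EXACTLY ONE of the points `x k ≫ j` lies on `W`.  Printed inputs BY NAME: `Γ ≅ (ℤ/5)⁴` (FV), the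
tangent-dimension fact.  Kernel ingredients: `transitive_of_split`, the odd torsor (both halves), the
dihedral fixed-space lemma, p1's `SplitPoints`.  CONDITIONAL; nothing is proved outright. -/
theorem count_of_split (hFV : FloccariVaresco2024_autFixingH2H3_equiv_kumType)
    (hT : GroupActions.Milne2017_fixedComponent_dim_eq_finrank_tangentFixed)
    {X : Motives.SchemeOver ℂ} (hX8 : Motives.IsSmoothProjective 8 X) (hKX : IsOfGeneralizedKummerType 4 X)
    (hsplit : ∀ δ : autFixingH2H3 X, δ ≠ 1 → ∀ ⦃F : Motives.SchemeOver ℂ⦄ (j : F ⟶ X),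
      IsFixedPointScheme (Subgroup.zpowers δ.val).subtype j →
      ∃ x : Fin 125 → (𝟙_ (Motives.SchemeOver ℂ) ⟶ F), Nonempty (IsColimit (Cofan.mk F x)))
    (ι : Aut X) {W : Motives.SchemeOver ℂ} (i : W ⟶ X) (hd : IsKummerFixedDatum X ι W i)
    (g : autFixingH2H3 X) (hg : g ≠ 1) {F : Motives.SchemeOver ℂ} (j : F ⟶ X)
    (hj : IsFixedPointScheme (Subgroup.zpowers g.val).subtype j)
    (x : Fin 125 → (𝟙_ (Motives.SchemeOver ℂ) ⟶ F)) (hx : IsColimit (Cofan.mk F x)) :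
    ∃ k₀ : Fin 125, (∃ p : 𝟙_ (Motives.SchemeOver ℂ) ⟶ W, p ≫ i = x k₀ ≫ j) ∧
      ∀ k, k ≠ k₀ → ∀ p : 𝟙_ (Motives.SchemeOver ℂ) ⟶ W, p ≫ i ≠ x k ≫ j := by
  classical
  haveI : IsProper X.hom := hX8.isProjectiveOver.isProper
  obtain ⟨hcomm, hcard, hpow5⟩ := gamma_comm_card_pow_five hFV hX8 hKX
  have hjg : j ≫ g.val.hom = j := hj.comp_hom ⟨g.val, Subgroup.mem_zpowers g.val⟩
  haveI : Mono j := hj.toIsFixedPointObject.mono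
  haveI := hd.isClosedImmersion
  haveI : Mono i := Over.mono_of_mono_left i
  -- involution identities
  have hιg : ι.hom ≫ g.val.hom ≫ ι.hom = g.val.inv := by
    have h' := congrArg Iso.hom (hd.conj_eq_inv g.val g.2)
    simp only [Aut.Aut_mul_def, Aut.Aut_inv_def, Iso.trans_hom, Iso.symm_hom] at h'
    exact h'
  have hι2 : ι.hom ≫ ι.hom = 𝟙 X := by
    have h' := congrArg Iso.hom hd.mul_self
    simp only [Aut.Aut_mul_def, Iso.trans_hom] at h'
    exact h'
  -- the `Γ`-set `S` of `g`-fixed sections with the twisted map `σ = (· ≫ ι)`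
  let S := {y : 𝟙_ (Motives.SchemeOver ℂ) ⟶ X // y ≫ g.val.hom = y}
  have hact_mem : ∀ (γ : autFixingH2H3 X) (y : S), (y.val ≫ γ.val.hom) ≫ g.val.hom = y.val ≫ γ.val.hom := by
    intro γ y
    have hγg : γ.val.hom ≫ g.val.hom = g.val.hom ≫ γ.val.hom := by
      have := congrArg (fun δ : autFixingH2H3 X => δ.val.hom) (hcomm g γ)
      simpa [Subgroup.coe_mul, Aut.Aut_mul_def] using this
    rw [Category.assoc, hγg, ← Category.assoc, y.property]
  let act : autFixingH2H3 X → S → S := fun γ y => ⟨y.val ≫ γ.val.hom, hact_mem γ y⟩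
  have hσ_mem : ∀ y : S, (y.val ≫ ι.hom) ≫ g.val.hom = y.val ≫ ι.hom := by
    intro y
    have hyinv : y.val ≫ g.val.inv = y.val := by
      calc y.val ≫ g.val.inv = (y.val ≫ g.val.hom) ≫ g.val.inv := by rw [y.property]
        _ = y.val := by rw [Category.assoc, Iso.hom_inv_id, Category.comp_id]
    have key : ι.hom ≫ g.val.hom = g.val.inv ≫ ι.hom := by
      calc ι.hom ≫ g.val.hom = (ι.hom ≫ g.val.hom ≫ ι.hom) ≫ ι.hom := by
            simp only [Category.assoc, hι2, Category.comp_id]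
        _ = g.val.inv ≫ ι.hom := by rw [hιg]
    rw [Category.assoc, key, ← Category.assoc, hyinv]
  let σ : S → S := fun y => ⟨y.val ≫ ι.hom, hσ_mem y⟩
  have hσ : ∀ γ (a : S), σ (act γ a) = act γ⁻¹ (σ a) := by
    intro γ a
    have hγ : ι.hom ≫ γ.val.hom ≫ ι.hom = γ.val.inv := by
      have h' := congrArg Iso.hom (hd.conj_eq_inv γ.val γ.2)
      simp only [Aut.Aut_mul_def, Aut.Aut_inv_def, Iso.trans_hom, Iso.symm_hom] at h'
      exact h'
    have key : γ.val.hom ≫ ι.hom = ι.hom ≫ γ.val.inv := by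
      calc γ.val.hom ≫ ι.hom = ι.hom ≫ (ι.hom ≫ γ.val.hom ≫ ι.hom) := by
            rw [← Category.assoc ι.hom, hι2, Category.id_comp]
        _ = ι.hom ≫ γ.val.inv := by rw [hγ]
    have h : (a.val ≫ γ.val.hom) ≫ ι.hom = (a.val ≫ ι.hom) ≫ γ.val.inv := by
      rw [Category.assoc, key, Category.assoc]
    exact Subtype.ext h
  have hact_mul : ∀ (p q : autFixingH2H3 X) (y : S), act (p * q) y = act p (act q y) :=
    fun p q y => Subtype.ext
      ((Category.assoc y.val q.val.hom p.val.hom).symm :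
        y.val ≫ (p * q).val.hom = (y.val ≫ q.val.hom) ≫ p.val.hom)
  have hodd : ∀ γ : autFixingH2H3 X, ∃ m : ℕ, γ ^ (2 * m + 1) = 1 :=
    fun γ => exists_pow_odd_eq_one_of_card hcard γ
  have htrans : ∀ a b : S, ∃ γ, act γ a = b := by
    intro a b
    obtain ⟨γ, hγ⟩ := transitive_of_split hFV hT hX8 hKX hsplit g hg a.val b.val a.property b.property
    exact ⟨γ, Subtype.ext hγ⟩
  -- EXISTENCE.  A `g`-fixed section exists (one of the `125`), hence an `ι`-fixed one `s*`
  let a₀ : S := ⟨x 0 ≫ j, by rw [Category.assoc, hjg]⟩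
  obtain ⟨s, hs⟩ := exists_fixed_of_transitive act hact_mul hodd htrans σ hσ a₀
  have hsg : s.val ≫ g.val.hom = s.val := s.property
  have hsι : s.val ≫ ι.hom = s.val := congrArg Subtype.val hs
  -- the complex point `P = s*`; `g, ι ∈ Stab(P)`; the tangent representation
  let P : Motives.ComplexPoints X := toUnit (Motives.specOver ℂ ℂ) ≫ s.val
  have hgP : g.val ∈ GroupActions.pointStabilizer X P := by
    rw [GroupActions.mem_pointStabilizer_iff, Motives.AlgPoints.map_apply]
    show (toUnit (Motives.specOver ℂ ℂ) ≫ s.val) ≫ g.val.hom = toUnit (Motives.specOver ℂ ℂ) ≫ s.val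
    rw [Category.assoc, hsg]
  have hιP : ι ∈ GroupActions.pointStabilizer X P := by
    rw [GroupActions.mem_pointStabilizer_iff, Motives.AlgPoints.map_apply]
    show (toUnit (Motives.specOver ℂ ℂ) ≫ s.val) ≫ ι.hom = toUnit (Motives.specOver ℂ ℂ) ≫ s.val
    rw [Category.assoc, hsι]
  obtain ⟨V, _, _, _, τ, hVn, hτ⟩ := hT hX8 P
  let φg : GroupActions.pointStabilizer X P := ⟨g.val, hgP⟩
  let φι : GroupActions.pointStabilizer X P := ⟨ι, hιP⟩
  obtain ⟨m, hm⟩ := hodd g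
  have hφg_pow : φg ^ (2 * m + 1) = 1 := by
    apply Subtype.ext
    rw [SubmonoidClass.coe_pow]
    show g.val ^ (2 * m + 1) = 1
    have := congrArg Subtype.val hm
    simpa using this
  have hφι_sq : φι * φι = 1 := Subtype.ext hd.mul_self
  have hφg_fin : IsOfFinOrder φg := isOfFinOrder_iff_pow_eq_one.2 ⟨2 * m + 1, by omega, hφg_pow⟩
  have hφι_fin : IsOfFinOrder φι :=
    isOfFinOrder_iff_pow_eq_one.2 ⟨2, by norm_num, by rw [pow_two, hφι_sq]⟩
  have hconjS : φι * φg * φι = φg⁻¹ := Subtype.ext (hd.conj_eq_inv g.val g.2)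
  -- `T^g = 0` (the fixed points of `g` are the split POINTS), hence `dim T^ι = 4` (dihedral lemma)
  have hfixv : ∀ v : V, τ φg v = v → v = 0 := tangentFixed_eq_zero_of_split τ hτ φg hφg_fin j hj x hx
  have hdim : Module.finrank ℂ (LinearMap.ker (τ φι - 1)) = 4 := by
    have h := Dihedral.two_mul_finrank_fixed_eq (isUnit_iff_ne_zero.2 (by norm_num : (2 : ℂ) ≠ 0))
      τ φg φι hφι_sq hconjS ⟨m, hφg_pow⟩ hfixv
    omega
  -- the partition of `Fix(ι)(ℂ)` given by the datum: `W` and the small components `G k`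
  obtain ⟨Kt, _, G, dG, iG, hGsp, hdG, hiG, hGG, hWG, hfixι⟩ := hd.2.2.2.2.2.2.2.2
  let Z : Option Kt → Motives.SchemeOver ℂ := fun o => o.elim W G
  let d : Option Kt → ℕ := fun o => o.elim 4 dG
  let c : ∀ o, Z o ⟶ X := fun o => match o with
    | none => i
    | some k => iG k
  have hZsp : ∀ o, Motives.IsSmoothProjective (d o) (Z o) := fun o => by
    cases o with
    | none => exact hd.isSmoothProjective
    | some k => exact hGsp k
  have hZci : ∀ o, IsClosedImmersion (c o).left := fun o => by
    cases o with
    | none => exact hd.isClosedImmersion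
    | some k => exact hiG k
  have hZdisj : ∀ o o' : Option Kt, o ≠ o' →
      Disjoint (Set.range (Motives.AlgPoints.mapContinuous (L := ℂ) (c o)))
        (Set.range (Motives.AlgPoints.mapContinuous (L := ℂ) (c o'))) := by
    intro o o' hoo'
    cases o with
    | none =>
      cases o' with
      | none => exact absurd rfl hoo'
      | some k' => exact hWG k'
    | some k =>
      cases o' with
      | none => exact (hWG k).symm
      | some k' => exact hGG k k' (fun h => hoo' (congrArg some h))
  have hZcov : {y : Motives.ComplexPoints X | Motives.AlgPoints.mapContinuous (L := ℂ) φι.val.hom y = y} =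
      ⋃ o, Set.range (Motives.AlgPoints.mapContinuous (L := ℂ) (c o)) := by
    rw [Set.iUnion_option]
    exact hfixι
  have hPfix : P ∈ {y : Motives.ComplexPoints X |
      Motives.AlgPoints.mapContinuous (L := ℂ) φι.val.hom y = y} := by
    show Motives.AlgPoints.mapContinuous (L := ℂ) ι.hom (toUnit (Motives.specOver ℂ ℂ) ≫ s.val) =
      toUnit (Motives.specOver ℂ ℂ) ≫ s.val
    rw [Motives.AlgPoints.mapContinuous_apply, Motives.AlgPoints.map_apply, Category.assoc, hsι]
  rw [hZcov, Set.mem_iUnion] at hPfix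
  obtain ⟨o₀, ho₀⟩ := hPfix
  have hdo₀ : d o₀ = 4 := by
    rw [← hdim]
    exact hτ φι hφι_fin (Option Kt) inferInstance Z d c hZsp hZci hZdisj hZcov o₀ ho₀
  -- the member through `P` has dimension `4`, so it is `W`: `s* = p₀ ≫ i`
  obtain ⟨p₀, hp₀⟩ : ∃ p₀ : 𝟙_ (Motives.SchemeOver ℂ) ⟶ W, p₀ ≫ i = s.val := by
    cases o₀ with
    | some k =>
      exfalso
      have h4 : dG k = 4 := hdo₀
      have h2 : dG k ≤ 2 := hdG k
      omega
    | none =>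
      obtain ⟨Q, hQ⟩ := ho₀
      have hQi : (Q ≫ i : Motives.ComplexPoints X) = toUnit (Motives.specOver ℂ ℂ) ≫ s.val := hQ
      exact ⟨Motives.toSpecOver (𝟙_ (Motives.SchemeOver ℂ)) ≫ Q,
        (Category.assoc _ _ _).trans
          ((congrArg (fun q : Motives.ComplexPoints X =>
              Motives.toSpecOver (𝟙_ (Motives.SchemeOver ℂ)) ≫ q) hQi).trans
            (toSpecOver_comp_toUnit_comp s.val))⟩
  -- `s*` is one of the split points: `s* = x k₀ ≫ j`
  have hinv₀ : ∀ a : Subgroup.zpowers g.val, s.val ≫ ((Subgroup.zpowers g.val).subtype a).hom = s.val :=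
    fun a => comp_hom_eq_of_mem_zpowers g.val s.val hsg a.val a.property
  obtain ⟨t₀, ht₀, -⟩ := hj.existsUnique_fac s.val hinv₀
  obtain ⟨k₀, rfl⟩ := SplitPoints.exists_eq x hx t₀
  refine ⟨k₀, ⟨p₀, hp₀.trans ht₀.symm⟩, fun k hk p hp => hk ?_⟩
  -- UNIQUENESS: `x k₀ ≫ j` and `x k ≫ j` are `g`-fixed and `ι`-fixed, hence equal (odd torsor)
  let a : S := ⟨x k₀ ≫ j, by rw [Category.assoc, hjg]⟩
  let b : S := ⟨x k ≫ j, by rw [Category.assoc, hjg]⟩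
  have ha' : (x k₀ ≫ j) ≫ ι.hom = x k₀ ≫ j := by rw [ht₀, ← hp₀, Category.assoc, hd.comp_hom]
  have hb' : (x k ≫ j) ≫ ι.hom = x k ≫ j := by rw [← hp, Category.assoc, hd.comp_hom]
  have hab : a = b :=
    eq_of_fixed_of_transitive act
      (fun y => Subtype.ext (Category.comp_id y.val : y.val ≫ (1 : autFixingH2H3 X).val.hom = y.val))
      hact_mul hodd htrans σ hσ (Subtype.ext ha') (Subtype.ext hb')
  have hjj : x k₀ ≫ j = x k ≫ j := congrArg Subtype.val hab
  exact (SplitPoints.injective x hx ((cancel_mono j).1 hjj)).symm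

/-! ### §5 I1geo on `X` from the split hypothesis -/

/-- **The fixed-point form of I1geo ON `X`**: under the split hypothesis, for every Kummer fixed datum
`(ι, W, i)` on `X` and `g ∈ Γ(X) ∖ 1` the `g`-fixed part of `W` is ONE REDUCED POINT — a section `p`
with `i(p)` fixed by `g` through which every `T`-point `r` of `W` with `i(r)` `g`-fixed factors. -/
theorem fixedPointForm_of_split (hFV : FloccariVaresco2024_autFixingH2H3_equiv_kumType)
    (hT : GroupActions.Milne2017_fixedComponent_dim_eq_finrank_tangentFixed)
    {X : Motives.SchemeOver ℂ} (hX8 : Motives.IsSmoothProjective 8 X) (hKX : IsOfGeneralizedKummerType 4 X)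
    (hsplit : ∀ δ : autFixingH2H3 X, δ ≠ 1 → ∀ ⦃F : Motives.SchemeOver ℂ⦄ (j : F ⟶ X),
      IsFixedPointScheme (Subgroup.zpowers δ.val).subtype j →
      ∃ x : Fin 125 → (𝟙_ (Motives.SchemeOver ℂ) ⟶ F), Nonempty (IsColimit (Cofan.mk F x)))
    (ι : Aut X) {W : Motives.SchemeOver ℂ} (i : W ⟶ X) (hd : IsKummerFixedDatum X ι W i)
    (g : autFixingH2H3 X) (hg : g ≠ 1) :
    ∃ p : 𝟙_ (Motives.SchemeOver ℂ) ⟶ W, (p ≫ i) ≫ g.val.hom = p ≫ i ∧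
      ∀ ⦃T : Motives.SchemeOver ℂ⦄ (r : T ⟶ W), (r ≫ i) ≫ g.val.hom = r ≫ i → r = toUnit T ≫ p := by
  haveI : IsProper X.hom := hX8.isProjectiveOver.isProper
  obtain ⟨-, hcard, -⟩ := gamma_comm_card_pow_five hFV hX8 hKX
  haveI : Finite (autFixingH2H3 X) := Nat.finite_of_card_ne_zero (by rw [hcard]; norm_num)
  haveI : Finite (Subgroup.zpowers g.val) := by
    have hle : Subgroup.zpowers g.val ≤ autFixingH2H3 X := (Subgroup.zpowers_le).2 g.2
    exact Set.Finite.subset (Set.toFinite (autFixingH2H3 X : Set (Aut X))) hle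
  obtain ⟨F, j, hj⟩ := exists_isFixedPointScheme (Subgroup.zpowers g.val).subtype
  obtain ⟨x, ⟨hx⟩⟩ := hsplit g hg j hj
  obtain ⟨k₀, ⟨p₀, hp₀⟩, huniq⟩ := count_of_split hFV hT hX8 hKX hsplit ι i hd g hg j hj x hx
  haveI := hd.isClosedImmersion
  exact ⟨p₀, fixedPointForm_of_split_fixedPointObject i g.val j hj.toIsFixedPointObject x hx k₀ p₀ hp₀ huniq⟩

/-- **I1geo ON `X`**: under the split hypothesis, `W ×_X gW ≅ Spec ℂ` for every Kummer fixed datum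
`(ι, W, i)` on `X` and every `g ∈ Γ(X) ∖ 1` — the statement of `Kum4FixedFourfoldMeetsTranslates` at
`X`, CONDITIONAL on FV, the tangent-dimension fact and the split hypothesis on `X`. -/
theorem meetsTranslates_of_split (hFV : FloccariVaresco2024_autFixingH2H3_equiv_kumType)
    (hT : GroupActions.Milne2017_fixedComponent_dim_eq_finrank_tangentFixed)
    {X : Motives.SchemeOver ℂ} (hX8 : Motives.IsSmoothProjective 8 X) (hKX : IsOfGeneralizedKummerType 4 X)
    (hsplit : ∀ δ : autFixingH2H3 X, δ ≠ 1 → ∀ ⦃F : Motives.SchemeOver ℂ⦄ (j : F ⟶ X),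
      IsFixedPointScheme (Subgroup.zpowers δ.val).subtype j →
      ∃ x : Fin 125 → (𝟙_ (Motives.SchemeOver ℂ) ⟶ F), Nonempty (IsColimit (Cofan.mk F x)))
    (ι : Aut X) {W : Motives.SchemeOver ℂ} (i : W ⟶ X) (hd : IsKummerFixedDatum X ι W i)
    (g : autFixingH2H3 X) (hg : g ≠ 1) :
    ∃ (p q : 𝟙_ (Motives.SchemeOver ℂ) ⟶ W), IsPullback p q i (i ≫ g.val.hom) := by
  obtain ⟨-, hcard, -⟩ := gamma_comm_card_pow_five hFV hX8 hKX
  obtain ⟨p₀, hfix, huniv⟩ := fixedPointForm_of_split hFV hT hX8 hKX hsplit ι i hd g hg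
  haveI := hd.isClosedImmersion
  haveI : Mono i := Over.mono_of_mono_left i
  have hconj : ι.hom ≫ g.val.hom ≫ ι.hom = g.val.inv := by
    have h' := congrArg Iso.hom (hd.conj_eq_inv g.val g.2)
    simp only [Aut.Aut_mul_def, Aut.Aut_inv_def, Iso.trans_hom, Iso.symm_hom] at h'
    exact h'
  obtain ⟨m, hm⟩ := exists_pow_odd_eq_one_of_card hcard g
  have hm' : (g : Aut X) ^ (2 * m + 1) = 1 := by exact_mod_cast hm
  exact ⟨p₀, p₀, (isPullback_unit_iff i ι g.val hd.comp_hom hconj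
    (fun T y hy => comp_hom_eq_of_comp_hom_hom_eq g.val m hm' y hy) p₀ p₀).2 ⟨rfl, hfix, huniv⟩⟩

end FixedPointsLocal

/-! ### §6 The route's statements: I1geo for all `X`, and the rung, from the split hypothesis -/

/-- **I1geo `Kum4FixedFourfoldMeetsTranslates` (all `X` of `Kum⁴`-type) from `Γ ≅ (ℤ/5)⁴`
(Floccari–Varesco, REFEREED), the tangent-dimension fact (Milne 13.1 / CGP A.8.10 / GW 6.28, REFEREED
textbook) and the SPLIT HYPOTHESIS for every smooth projective `X` of `Kum⁴`-type** («the fixed-point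
scheme of `⟨g⟩`, `g ∈ Γ(X) ∖ 1`, is `125` reduced points» — an inline binder, NOT a tree fact for
general `X`; at `K⁴(A)` it is Oguiso 2020 Prop. 3.5–3.6).  CONDITIONAL; nothing is proved outright. -/
theorem kum4FixedFourfoldMeetsTranslates_of_fixedPointsSplit
    (hFV : FloccariVaresco2024_autFixingH2H3_equiv_kumType)
    (hT : GroupActions.Milne2017_fixedComponent_dim_eq_finrank_tangentFixed)
    (hsplitX : ∀ ⦃X : Motives.SchemeOver ℂ⦄, Motives.IsSmoothProjective 8 X →
      IsOfGeneralizedKummerType 4 X → ∀ δ : autFixingH2H3 X, δ ≠ 1 →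
        ∀ ⦃F : Motives.SchemeOver ℂ⦄ (j : F ⟶ X), IsFixedPointScheme (Subgroup.zpowers δ.val).subtype j →
          ∃ x : Fin 125 → (𝟙_ (Motives.SchemeOver ℂ) ⟶ F), Nonempty (IsColimit (Cofan.mk F x))) :
    Kum4FixedFourfoldMeetsTranslates :=
  fun _ hX8 hKX ι _ i hd g hg =>
    FixedPointsLocal.meetsTranslates_of_split hFV hT hX8 hKX (hsplitX hX8 hKX) ι i hd g hg

/-- **H3 for `Kum⁴`-type and its powers from REFEREED PRINT + the split hypothesis + L1** — sixteen
binders: fourteen REFEREED named facts (the twelve of `hc_kum4Type_of_L1_of_meetsTranslates`, `Γ ≅ (ℤ/5)⁴`,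
the tangent-dimension fact), the SPLIT HYPOTHESIS for every smooth projective `X` of `Kum⁴`-type (inline;
in print a routine consequence of Hassett–Tschinkel 2013 Thm. 2.1 and Oguiso 2020 Prop. 3.6, NOT typed
by the cell), and p1's cell lemma L1.  NO cohomological transport (T), NO Kummer-point statement, NO
(H2).  CONDITIONAL on all of them; nothing here says `HC_Kum4Type` or the Hodge conjecture is proved
outright. -/
theorem hc_kum4Type_of_L1_of_fixedPointsSplit
    (hOGV : OGradyVoisin2022_thirdJacobian_kugaSatake_kummerType)
    (hFF : FloccariFu2026_hodgeClasses_algebraic_powers_discOneWeilFourfold)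
    (hFo : Foster2024_lefschetzStandard_kummerType_prime)
    (hAn : Andre1996_dualLefschetz_mem_adjoin_lefschetzInvolution)
    (hA1 : Hirzebruch1969_gSignature_involution_halfDimFixedLocus)
    (hA2 : Floccari2026_fixedFourfold_kum4Type)
    (hHIR : Voisin2002_hodgeIndex_hodgeRiemann_middle)
    (hGS : GoettscheSoergel1993_chiY_kum4Type)
    (hGK : GreenKimLazaRobles2022_llvTrivial_isOfHodgeType_kumType)
    (hF : Foster2024_translationAction_kum4Type)
    (hcardF : Floccari2026_card_autFixingH2H3_kum4Type)
    (hFu : Fulton1998_cupPairing_transversalPoint)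
    (hFV : FloccariVaresco2024_autFixingH2H3_equiv_kumType)
    (hTan : GroupActions.Milne2017_fixedComponent_dim_eq_finrank_tangentFixed)
    (hsplitX : ∀ ⦃X : Motives.SchemeOver ℂ⦄, Motives.IsSmoothProjective 8 X →
      IsOfGeneralizedKummerType 4 X → ∀ δ : autFixingH2H3 X, δ ≠ 1 →
        ∀ ⦃F : Motives.SchemeOver ℂ⦄ (j : F ⟶ X), IsFixedPointScheme (Subgroup.zpowers δ.val).subtype j →
          ∃ x : Fin 125 → (𝟙_ (Motives.SchemeOver ℂ) ⟶ F), Nonempty (IsColimit (Cofan.mk F x)))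
    (hL1 : LefschetzGenerationKum4) :
    Summit.Ventures.HodgeKum4.HC_Kum4Type ∧ Summit.Ventures.HodgeKum4.HC_Kum4TypePowers :=
  hc_kum4Type_of_L1_of_meetsTranslates hOGV hFF hFo hAn hA1 hA2 hHIR hGS hGK hF hcardF hFu hL1
    (kum4FixedFourfoldMeetsTranslates_of_fixedPointsSplit hFV hTan hsplitX)

/-- **At the Kummer varieties the split hypothesis IS Oguiso's printed fact**: the restricted residual
`Kum4FixedFourfoldMeetsTranslatesAtKummer` (I1geo at every `K⁴(A)`) from `Γ ≅ (ℤ/5)⁴` (FV), Oguiso 2020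
Prop. 3.5–3.6 and the tangent-dimension fact — the landed chain (`…TransitiveTangent`,
`…HasFixedPointTangent`, `…PointCountAssembly`, `…KummerPointAssembly`) re-derived from the X-local
theorems.  CONDITIONAL on the three printed statements. -/
theorem kum4FixedFourfoldMeetsTranslatesAtKummer_of_split_oguiso
    (hFV : FloccariVaresco2024_autFixingH2H3_equiv_kumType)
    (hOg : Oguiso2020_fixedPointScheme_translation_generalizedKummerFour)
    (hT : GroupActions.Milne2017_fixedComponent_dim_eq_finrank_tangentFixed) :
    Kum4FixedFourfoldMeetsTranslatesAtKummer := by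
  intro A K hA hKum hK8 ι₀ W₀ i₀ hd g hg
  obtain ⟨M⟩ := HodgeTheory.nonempty_hodgeModel_holds (n := 8) (X := K) hK8
  have hKK : IsOfGeneralizedKummerType 4 K := IsOfGeneralizedKummerType.of_hodgeModel (n := 4) hA hKum hK8 M
  exact FixedPointsLocal.meetsTranslates_of_split hFV hT hK8 hKK
    (fun δ hδ F j hj => hOg hA hKum hK8 δ hδ j hj) ι₀ i₀ hd g hg

end Summit.Ventures.HodgeKum4

end
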